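import Summits.BirchSwinnertonDyer.BirchSwinnertonDyer.Theorems.UniversalToricDescentTowerDescent
import Summits.BirchSwinnertonDyer.BirchSwinnertonDyer.Theorems.UniversalToricDescentCofiniteDivisiblePart
import HarnessLib

/-!
# Procyclic descent at the layers of a local `ℤ_p`-tower, INFINITE fixed part: `#ker(H¹(G_n, A) → H¹(H, A)) ≤ [A^H : (A^H)_div]`
# uniformly in `n` (crux ♭T≤ stmt-BirchSwinnertonDyer-23042, line `sigmacongruence`, stub R1 `stub_relaxedImageCount`, brick (c))

Route `UniversalToricDescent`, lead prover `bsd-wall-utd-p1` g18. THEOREMS ONLY (no definition, no named fact, no `sorry`);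
`--supports stmt-BirchSwinnertonDyer-23042`. BSD is not proved by any of this.

Setting of `…TowerDescent` (g17): profinite `G`, `κ₀ : G → ℤ_p` with exact index `c` (`κ₀ δ₁ = p^c`), layers `G_n = κ₀⁻¹(p^{c+n}ℤ_p)`,
`H = ker κ₀`, a discrete `p`-primary `G`-module `A` with open stabilisers. There `natCard_ker_resOfLe_le` bounds the descent kernel by
`#A^H` when `A^H` is FINITE (the strict place `𝔭′`). At a TAME place `v` the fixed part `A^H = E′(K_{∞,w})[p^∞]` is in general
INFINITE (cofree of corank `s_v`, plus a finite part). Here: if `A^H[p]` is finite and `A^{G_n}` is finite, the kernel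
`A^H/(γ_n⁻¹ − 1)A^H` (`ProcyclicDescent.natCard_ker_resSubgroup_eq`, exact) is bounded by the index of the DIVISIBLE PART of `A^H`
(`…CofiniteDivisiblePart.natCard_quotient_range_le_of_finite_ker`: an endomorphism with finite kernel is onto the divisible part),
a constant INDEPENDENT of `n`.

* `smul_eq_self_of_mem_layer` — an element of `A^H` with the uniform stabiliser property (A2) fixed by `δ₁^{p^n}` is fixed by all of `G_n`.
* **`natCard_ker_resOfLe_le_index`** — `Finite ker ∧ #ker(res : H¹(G_n, A) → H¹(H, A)) ≤ #(A^H / D)` for the divisible part `D` of `A^H`.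

References: [GreenbergLNM1716] §3 proof of Lemma 3.3 (p. 87); [GreenbergVatsal2000] §2 Prop. (2.4) (p. 22: `𝓗_v` and `E(K_{∞,η})[p^∞]`);
[SerreGaloisCohomology1997] XIII §1; [Fuchs1970] §21.
-/

set_option linter.dupNamespace false
set_option autoImplicit false

noncomputable section

open scoped Classical
open Function
open Literature.NumberTheory.EllipticCurves
  Summit.BirchSwinnertonDyer.Rank1Residual.X11b Summit.BirchSwinnertonDyer.Rank1Residual.X11b.ProcyclicDescent
  Summit.BirchSwinnertonDyer.BirchSwinnertonDyer.Theorems.UniversalToricDescentTowerDescent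
  Summit.BirchSwinnertonDyer.BirchSwinnertonDyer.Theorems.UniversalToricDescentCofiniteDivisiblePart

universe u

namespace Summit.BirchSwinnertonDyer.BirchSwinnertonDyer.Theorems.UniversalToricDescentTowerDescentIndex

variable {G : Type u} [Group G] [TopologicalSpace G] [IsTopologicalGroup G]
variable {A : Type u} [AddCommGroup A] [DistribMulAction G A] [TopologicalSpace A] [DiscreteTopology A]
variable {p : ℕ} [Fact p.Prime] (κ₀ : G →ₜ* Multiplicative ℤ_[p])
variable {c : ℕ} {δ₁ : G} (hδ₁ : (κ₀ δ₁).toAdd = (p : ℤ_[p]) ^ c)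
variable {Gn : Subgroup G} {n : ℕ} (hGn : ∀ g : G, g ∈ Gn ↔ (p : ℤ_[p]) ^ (c + n) ∣ (κ₀ g).toAdd)

/-! ## §1 Fixed by `H` and `δ₁^{p^n}` ⟹ fixed by `G_n` -/

omit [IsTopologicalGroup G] [TopologicalSpace A] [DiscreteTopology A] in
include hδ₁ hGn in
/-- **An element of `A^H` fixed by `δ₁^{p^n}` is fixed by every `g ∈ G_n`**, granted the uniform stabiliser property (A2) for that
element, «`∃ t, p^t ∣ κ₀ g ⟹ g • a = a`»: write `g = (δ₁^{p^n})^m g′` with `κ₀ g′ ∈ p^{c+n+t}ℤ_p` (`PadicInt.appr`), as in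
`…TowerDescent.conjH1_pow_eq_self_iff_forall_layer`. [cite: Washington1997, §13.1] -/
theorem smul_eq_self_of_mem_layer {a : A} (hstab : ∃ t : ℕ, ∀ g : G, (p : ℤ_[p]) ^ t ∣ (κ₀ g).toAdd → g • a = a)
    (hγ : δ₁ ^ p ^ n • a = a) {g : G} (hg : g ∈ Gn) : g • a = a := by
  obtain ⟨t, ht⟩ := hstab
  obtain ⟨z, hz⟩ := (hGn g).mp hg
  obtain ⟨w, hw⟩ := Ideal.mem_span_singleton.mp (PadicInt.appr_spec t z)
  set m : ℕ := z.appr t with hm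
  set g' : G := ((δ₁ ^ p ^ n) ^ m)⁻¹ * g with hg'
  have hκg' : (κ₀ g').toAdd = (p : ℤ_[p]) ^ (c + n) * ((p : ℤ_[p]) ^ t * w) := by
    rw [hg', map_mul κ₀, map_inv κ₀, toAdd_mul, toAdd_inv, ← pow_mul, map_pow κ₀, ← ofAdd_toAdd (κ₀ δ₁), ← ofAdd_nsmul,
      toAdd_ofAdd, hδ₁, hz, nsmul_eq_mul, Nat.cast_mul, Nat.cast_pow, pow_add]
    linear_combination (p : ℤ_[p]) ^ c * (p : ℤ_[p]) ^ n * hw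
  have hfix' : g' • a = a := ht g' ⟨(p : ℤ_[p]) ^ (c + n) * w, by rw [hκg']; ring⟩
  have hpow : ∀ j : ℕ, (δ₁ ^ p ^ n) ^ j • a = a := by
    intro j
    induction j with
    | zero => rw [pow_zero, one_smul]
    | succ j ih => rw [pow_succ, mul_smul, hγ, ih]
  have e : g = (δ₁ ^ p ^ n) ^ m * g' := by rw [hg', mul_inv_cancel_left]
  rw [e, mul_smul, hfix', hpow]

/-! ## §2 The descent kernel is bounded by the index of the divisible part of `A^H` -/

include hδ₁ hGn in
/-- **`#ker(res : H¹(G_n, A) → H¹(H, A)) ≤ #(A^H/D)`** (`H = ker κ₀`, `D` the subgroup of `p`-divisible elements of `A^H`, of finite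
index): the kernel is `A^H/(γ_n⁻¹ − 1)A^H` (`γ_n = δ₁^{p^n}`, the tree's `ProcyclicDescent.natCard_ker_resSubgroup_eq` for the rescaled
character of `G_n`), and `γ_n⁻¹ − 1` has finite kernel on `A^H` (inside the finite `A^{G_n}`, §1), so it is onto `D`
(`…CofiniteDivisiblePart.natCard_quotient_range_le_of_finite_ker`). The bound does not depend on `n`.
[cite: GreenbergLNM1716, §3 proof of Lemma 3.3 (p. 87)] [cite: GreenbergVatsal2000, §2 Prop. (2.4) (p. 22)] -/
theorem natCard_ker_resOfLe_le_index [CompactSpace G] [T2Space G] [TotallyDisconnectedSpace G]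
    (hA : ∀ a : A, IsOpen {g : G | g • a = a}) (hAt : Literature.NumberTheory.GaloisRepresentations.IsPrimaryTorsion p A)
    (hGc : IsClosed (Gn : Set G))
    (AH : AddSubgroup A) (hAH : ∀ a : A, a ∈ AH ↔ ∀ g : G, κ₀ g = 1 → g • a = a)
    (hstab : ∀ a ∈ AH, ∃ t : ℕ, ∀ g : G, (p : ℤ_[p]) ^ t ∣ (κ₀ g).toAdd → g • a = a)
    (hfinp : Set.Finite {a : AH | p • a = 0})
    (hfinGn : Set.Finite {a : A | ∀ g : G, g ∈ Gn → g • a = a})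
    (D : AddSubgroup AH) (hDmem : ∀ b : AH, b ∈ D ↔ ∀ k : ℕ, ∃ c : AH, p ^ k • c = b)
    (hDdiv : ∀ d ∈ D, ∃ d' ∈ D, p • d' = d) [Finite (AH ⧸ D)] :
    Finite (resOfLe A (kerK_le_layer κ₀ hGn)).ker ∧
      Nat.card (resOfLe A (kerK_le_layer κ₀ hGn)).ker ≤ Nat.card (AH ⧸ D) := by
  have hp : p.Prime := Fact.out
  haveI : CompactSpace Gn := isCompact_iff_compactSpace.mp hGc.isCompact
  have hH : kerK κ₀ ≤ Gn := kerK_le_layer κ₀ hGn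
  have hAn : ∀ a : A, IsOpen {g : Gn | g • a = a} := fun a ↦ (hA a).preimage continuous_subtype_val
  -- the rescaled character of `G_n`
  have hdiv : ∀ g : Gn, (p : ℤ_[p]) ^ (c + n) ∣ (κ₀.comp (subgroupIncl Gn) g).toAdd := fun g ↦ dvd_of_mem_layer κ₀ hGn g
  let γn : Gn := ⟨δ₁ ^ p ^ n, by simpa only [mul_one] using pow_pow_mul_mem_layer κ₀ hδ₁ hGn 1⟩
  have hγn : (κ₀.comp (subgroupIncl Gn) γn).toAdd = (p : ℤ_[p]) ^ (c + n) := toAdd_apply_pow (n := n) κ₀ hδ₁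
  have hsurj := ProcyclicDescent.rescale_surjective (κ₀.comp (subgroupIncl Gn)) (c + n) hdiv γn hγn
  have hone := ProcyclicDescent.rescale_eq_one (κ₀.comp (subgroupIncl Gn)) (c + n) hdiv γn hγn
  have hker : kerK (ProcyclicDescent.rescale (κ₀.comp (subgroupIncl Gn)) (c + n) hdiv) = kerK (κ₀.comp (subgroupIncl Gn)) :=
    ProcyclicDescent.kerK_rescale (κ₀.comp (subgroupIncl Gn)) (c + n) hdiv
  have hcount := ProcyclicDescent.natCard_ker_resSubgroup_eq hAn
    (ProcyclicDescent.rescale (κ₀.comp (subgroupIncl Gn)) (c + n) hdiv) hsurj hone hAt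
  -- the two kernels coincide
  obtain ⟨τ, -, hτr⟩ := exists_transport (A := A) κ₀ hH
  have hkers : (resOfLe A hH).ker =
      (ResKernel.resSubgroup (kerK (ProcyclicDescent.rescale (κ₀.comp (subgroupIncl Gn)) (c + n) hdiv)) A).ker := by
    ext z
    rw [AddMonoidHom.mem_ker, AddMonoidHom.mem_ker, ← ProcyclicDescent.resOfLe_comp_resSubgroup (A := A) hker.le,
      AddMonoidHom.comp_apply]
    constructor
    · intro h
      rw [← hτr, h, map_zero, map_zero]
    · intro h
      have h' := congrArg (resOfLe A hker.ge) h
      rw [ProcyclicDescent.resOfLe_resOfLe_of_eq (A := A) hker, map_zero, ← hτr] at h'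
      exact τ.injective (by rw [h', map_zero])
  -- the fixed subgroup of the rescaled kernel IS `AH`
  set Fn := ProcyclicDescent.fixedSubgroup (A := A)
      (kerK (ProcyclicDescent.rescale (κ₀.comp (subgroupIncl Gn)) (c + n) hdiv)) with hFn
  have hFeq : Fn = AH := by
    ext a
    rw [hFn, ProcyclicDescent.mem_fixedSubgroup_iff, hAH]
    constructor
    · intro h g hg
      have hgn : g ∈ Gn := hH hg
      have hmem : (⟨g, hgn⟩ : Gn) ∈ kerK (ProcyclicDescent.rescale (κ₀.comp (subgroupIncl Gn)) (c + n) hdiv) := by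
        rw [hker]; exact hg
      exact h ⟨⟨g, hgn⟩, hmem⟩
    · intro h x
      have hx : ((x : Gn) : G) ∈ kerK κ₀ := by
        have h2 : (x : Gn) ∈ kerK (κ₀.comp (subgroupIncl Gn)) := hker ▸ x.2
        exact h2
      exact h _ hx
  -- transport `γ_n⁻¹ − 1` to `AH`
  let e : Fn ≃+ AH := AddEquiv.addSubgroupCongr hFeq
  have he : ∀ x : Fn, ((e x : AH) : A) = (x : A) := fun _ ↦ rfl
  have hesymm : ∀ y : AH, ((e.symm y : Fn) : A) = (y : A) := fun _ ↦ rfl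
  let ψ := ProcyclicDescent.subOneFixed (A := A)
      (kerK (ProcyclicDescent.rescale (κ₀.comp (subgroupIncl Gn)) (c + n) hdiv)) γn
  let φ : AH →+ AH := e.toAddMonoidHom.comp (ψ.comp e.symm.toAddMonoidHom)
  have hφ : ∀ y : AH, ((φ y : AH) : A) = (δ₁ ^ p ^ n)⁻¹ • (y : A) - y := fun y ↦ by
    change ((e (ψ (e.symm y)) : AH) : A) = _
    rw [he, ProcyclicDescent.coe_subOneFixed_apply, hesymm]
    rfl
  have hrange : (ψ.range).map (e : Fn →+ AH) = φ.range := by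
    ext y
    constructor
    · rintro ⟨x, ⟨z, rfl⟩, rfl⟩
      exact ⟨e z, by change e (ψ (e.symm (e z))) = e (ψ z); rw [e.symm_apply_apply]⟩
    · rintro ⟨z, rfl⟩
      exact ⟨ψ (e.symm z), ⟨e.symm z, rfl⟩, rfl⟩
  have hcongr : Nat.card (Fn ⧸ ψ.range) = Nat.card (AH ⧸ φ.range) :=
    Nat.card_congr (QuotientAddGroup.congr ψ.range φ.range e hrange).toEquiv
  -- the kernel of `φ` is finite: inside `A^{G_n}` (§1)
  have hkerφ : Set.Finite (φ.ker : Set AH) := by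
    have hsub : ∀ y : AH, y ∈ (φ.ker : Set AH) → (y : A) ∈ {a : A | ∀ g : G, g ∈ Gn → g • a = a} := by
      intro y hy
      have hy0 : ((φ y : AH) : A) = 0 := by
        have : φ y = 0 := hy
        rw [this]; rfl
      rw [hφ, sub_eq_zero] at hy0
      have hγ : δ₁ ^ p ^ n • (y : A) = y := by
        have h := congrArg (fun b : A ↦ δ₁ ^ p ^ n • b) hy0
        simp only [smul_inv_smul] at h
        exact h.symm
      intro g hg
      exact smul_eq_self_of_mem_layer κ₀ hδ₁ hGn (hstab y y.2) hγ hg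
    exact (hfinGn.preimage Subtype.val_injective.injOn).subset fun y hy ↦ hsub y hy
  -- `AH` is `p`-primary
  have hB : ∀ b : AH, ∃ m : ℕ, p ^ m • b = 0 := fun b ↦ by
    obtain ⟨m, hm⟩ := hAt (b : A)
    exact ⟨m, Subtype.ext (by rw [AddSubgroupClass.coe_nsmul]; exact hm)⟩
  obtain ⟨hfinQ, hle⟩ := natCard_quotient_range_le_of_finite_ker hp hB hfinp hDmem hDdiv φ hkerφ
  haveI : Finite (AH ⧸ φ.range) := hfinQ
  haveI hfinFn : Finite (Fn ⧸ ψ.range) :=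
    Finite.of_equiv _ (QuotientAddGroup.congr ψ.range φ.range e hrange).toEquiv.symm
  rw [hkers, hcount]
  refine ⟨Finite.of_equiv _ (ProcyclicDescent.kerResEquiv hAn
      (ProcyclicDescent.rescale (κ₀.comp (subgroupIncl Gn)) (c + n) hdiv) hsurj hone hAt).toEquiv, ?_⟩
  change Nat.card (Fn ⧸ ψ.range) ≤ _
  rw [hcongr]
  exact hle

end Summit.BirchSwinnertonDyer.BirchSwinnertonDyer.Theorems.UniversalToricDescentTowerDescentIndex

end
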